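import Summits.BirchSwinnertonDyer.BirchSwinnertonDyer.Theses.UniversalToricDescent
import Literature.NumberTheory.EllipticCurves.TwoVariableSelmerDual
import Literature.NumberTheory.EllipticCurves.ToricTwoVariablePAdicLFunctionUpTo
import Summits.BirchSwinnertonDyer.BirchSwinnertonDyer.Theorems.UniversalToricDescentThinCombDefs

/-!
# PROMOTION PREFLIGHT for stub 3 `stub_ratCombDvdUpTo2` of line `ratwall_thin_comb` v8.2 (crux stmt-BirchSwinnertonDyer-24207
# `UniversalToricDescent.RationalSplitIMCInclusionAtThree`, registered skeleton sha 64562c1022de) — LEAD cruxlead-24207 g22, 2026-08-30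

Purpose (answer to the L4 hand-back `promote-stub`, g16–g22, and to the UTD pen's typability preflight, pss3x g11 05:10Z): the
REGISTERED signature of stub 3, spelled in ROUTE-FILE VOCABULARY (fully qualified, no `open`, no `letI`, no notation beyond what
`Theses/UniversalToricDescent.lean` already uses: `ℂ_[3]`, `ℤ`-casts), so that a planner can file it VERBATIM as a statement item.

§1 `RatCombDvdUpTo2AtThree` — the item text. IMPORT DELTA for `Theses/UniversalToricDescent.lean` (rev 91 imports checked 05:3xZ):
the route file must additionally import EXACTLY
  `Literature.NumberTheory.EllipticCurves.TwoVariableSelmerDual`            (for `WeierstrassCurve.XGr₂`, `ZpExtension.IsTopGeneratorPair`, `IwasawaAlgebra₂`)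
  `Literature.NumberTheory.EllipticCurves.ToricTwoVariablePAdicLFunctionUpTo` (for `IsToricTwoVarLFunctionUpTo₂`, p731489/p739474)
  `Summits.BirchSwinnertonDyer.BirchSwinnertonDyer.Theorems.UniversalToricDescentThinCombDefs` (for `ThinCombDvdRat`; that file imports
  only `Mathlib` + `HarnessLib`, so NO import cycle with the route file; the two Literature modules import only Literature/HarnessLib).
This file imports the route file + exactly these three modules and nothing else: rc 0 here = the text elaborates in that environment.
§2 `iff_registered` — the item text is `Iff.rfl`-equal to the registered stub signature as written in the skeleton (with its `open`s).
§3 `stub_ratCombDvdUpTo2_of_item` — the stub VERBATIM from the item (term `h`): the day the item has a decl `D`, the skeleton's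
`sorry` at :401 becomes `D_holds …`/a hypothesis in the landing pad `Theorems/…ClosedModuloPrint.lean` pattern (p754883).
HONEST: this is bookkeeping; it proves nothing about any curve; the statement is an OPEN CONJECTURE-class claim (Gu arXiv:2512.01184
Conj. 2.15 / Loeffler arXiv:2003.13738 Conj. 2.8 road); BSD is proved for no curve; 24207 OPEN.
-/

set_option linter.dupNamespace false
set_option autoImplicit false

namespace Summit.BirchSwinnertonDyer.BirchSwinnertonDyer.Cruxes.RationalSplitIMCInclusionAtThree.RatwallThinComb.Stub3ItemText

/-- **Item text (route-file vocabulary) of stub 3 `stub_ratCombDvdUpTo2`** — two-variable RATIONAL Beilinson–Flach thin-comb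
divisibility at the additive split 3: for `E/ℚ` wild of class O6 at `3`, `ρ̄_{E,3}` onto, `r_an = 1`, conductor `N`, `K` imaginary
quadratic Heegner for `N` with `3 = 𝔭𝔭′` split (`𝔭` of degree one), `ι′` inducing `𝔭`, a generator pair `(κ₁, κ₂; γ₁, γ₂)` of the
`ℤ₃²`-extension with `κ₁` unramified outside `𝔭`, `X₂ = X_{∅ at 𝔭, nr at 𝔭′}(E/K̃_∞)` finitely generated and torsion over `Λ₂` with
`Ch_{Λ₂}(X₂) = (g)`: every ♯♯-frame `L₂` (`IsToricTwoVarLFunctionUpTo₂ C X Y …`, constants `C, X, Y ∈ ℂ_3ˣ`, CM period `Ω_K′ ≠ 0`)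
satisfies `ThinCombDvdRat R₀ 3 g L₂` (on comb levels of unbounded order, `3^{t_m}·L₂ ∈ (g, E_m(T₂))` for some slack `t_m`).
STATUS: open conjecture-class (the only printed road is a BF Euler system + explicit reciprocity over the universal-deformation
family through `f_E` at the supercuspidal 3). [cite: Gu2025FiniteSlopeUniversalRS, Conj. 2.15, Rem. 2.16 (arXiv:2512.01184)]
[cite: Loeffler2023UniversalDeformation, Conj. 2.8 (arXiv:2003.13738)] [cite: KingsLoefflerZerbes2017, Thm. 11.6.4] -/
def RatCombDvdUpTo2AtThree : Prop :=
  ∀ (W : WeierstrassCurve ℚ) [W.IsElliptic] [W.IsGloballyMinimal] (N : ℕ) [NeZero N] (K : Type) [Field K] [NumberField K] (Dt : Literature.NumberTheory.EllipticCurves.ModularForms.ModularParametrizationData W N), Summit.BirchSwinnertonDyer.Rank1Residual.Additive.ClassO6 W 3 → W.HasSurjectiveModNGaloisRep 3 → W.analyticRank = 1 → W.conductorNorm ℤ = N → Literature.NumberTheory.EllipticCurves.IsImaginaryQuadratic K → Literature.NumberTheory.EllipticCurves.SatisfiesHeegnerHypothesis N K → ∀ (𝔭 : IsDedekindDomain.HeightOneSpectrum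 (NumberField.RingOfIntegers K)), ((3 : ℕ) : NumberField.RingOfIntegers K) ∈ 𝔭.asIdeal → 𝔭.asIdeal.ramificationIdx (NumberField.RingOfIntegers ℚ) = 1 → 𝔭.asIdeal.inertiaDeg (NumberField.RingOfIntegers ℚ) = 1 → ∀ (𝔭' : IsDedekindDomain.HeightOneSpectrum (NumberField.RingOfIntegers K)), ((3 : ℕ) : NumberField.RingOfIntegers K) ∈ 𝔭'.asIdeal → 𝔭' ≠ 𝔭 → ∀ (ι' : PadicAlgCl 3 ≃+* ℂ), Summit.BirchSwinnertonDyer.BirchSwinnertonDyer.Theorems.SchneiderFree.BranchInducesPrime 3 ι' 𝔭 → ∀ (κ₁ κ₂ : Literature.NumberTheory.EllipticCurves.ZpExtension K 3) (γ₁ γ₂ : Field.absoluteGaloisGroup K) [Fact (Literature.NumberTheory.EllipticCurves.ZpExtension.IsTopGeneratorPair κ₁ κ₂ γ₁ γ₂)], (∀ v : IsDedekindDomain.HeightOneSpectrum (NumberField.RingOfIntegers K), v ≠ 𝔭 → ∀ 𝔓 ∈ v.primesAbove, 𝔓.inertia (Field.absoluteGaloisGroup K) ≤ κ₁.kerSubgroup)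 → Module.Finite (Literature.NumberTheory.EllipticCurves.IwasawaAlgebra₂ 3) ((W.baseChange K).XGr₂ 3 κ₁ κ₂ 𝔭' γ₁ γ₂) → Module.IsTorsion (Literature.NumberTheory.EllipticCurves.IwasawaAlgebra₂ 3) ((W.baseChange K).XGr₂ 3 κ₁ κ₂ 𝔭' γ₁ γ₂) → ∀ (g : Literature.NumberTheory.EllipticCurves.IwasawaAlgebra₂ 3), Literature.NumberTheory.EllipticCurves.Module.charIdeal (Literature.NumberTheory.EllipticCurves.IwasawaAlgebra₂ 3) ((W.baseChange K).XGr₂ 3 κ₁ κ₂ 𝔭' γ₁ γ₂) = Ideal.span {g} → ∀ (ΩK' : ℂ) (C X Y : ℂ_[3]) (L₂ : PowerSeries (PowerSeries (Literature.NumberTheory.EllipticCurves.unrIntegers 3))), ΩK' ≠ 0 → C ≠ 0 → X ≠ 0 → Y ≠ 0 → Literature.NumberTheory.EllipticCurves.IsToricTwoVarLFunctionUpTo₂ C X Y ι' 𝔭 𝔭' κ₁ κ₂ γ₁ γ₂ Dt.f ΩK' L₂ → Summit.BirchSwinnertonDyer.BirchSwinnertonDyer.Theorems.UniversalToricDescentThinComb.ThinCombDvdRat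 (Literature.NumberTheory.EllipticCurves.unrIntegers 3) 3 (PowerSeries.map (PowerSeries.map (Summit.BirchSwinnertonDyer.Rank1Residual.X11b.Halves.toUnr 3)) g) L₂

section Registered

open NumberField IsDedekindDomain Field
open Literature.NumberTheory.EllipticCurves Literature.NumberTheory.GaloisRepresentations
open Literature.NumberTheory.EllipticCurves.ModularForms
open Summit.BirchSwinnertonDyer.BirchSwinnertonDyer.Theorems.UniversalToricDescentThinComb

/-- The item text IS the registered stub signature (skeleton v8.2 :379–:400, with the skeleton's `open`s): `Iff.rfl`. [bookkeeping] -/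
theorem iff_registered : RatCombDvdUpTo2AtThree ↔
    (∀ (W : WeierstrassCurve ℚ) [W.IsElliptic] [W.IsGloballyMinimal] (N : ℕ) [NeZero N] (K : Type) [Field K]
      [NumberField K] (Dt : Literature.NumberTheory.EllipticCurves.ModularForms.ModularParametrizationData W N),
    Summit.BirchSwinnertonDyer.Rank1Residual.Additive.ClassO6 W 3 → W.HasSurjectiveModNGaloisRep 3 →
    W.analyticRank = 1 → W.conductorNorm ℤ = N → IsImaginaryQuadratic K → SatisfiesHeegnerHypothesis N K →
    ∀ (𝔭 : HeightOneSpectrum (𝓞 K)), ((3 : ℕ) : 𝓞 K) ∈ 𝔭.asIdeal →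
      𝔭.asIdeal.ramificationIdx (𝓞 ℚ) = 1 → 𝔭.asIdeal.inertiaDeg (𝓞 ℚ) = 1 →
    ∀ (𝔭' : HeightOneSpectrum (𝓞 K)), ((3 : ℕ) : 𝓞 K) ∈ 𝔭'.asIdeal → 𝔭' ≠ 𝔭 →
    ∀ (ι' : PadicAlgCl 3 ≃+* ℂ), Summit.BirchSwinnertonDyer.BirchSwinnertonDyer.Theorems.SchneiderFree.BranchInducesPrime 3 ι' 𝔭 →
    ∀ (κ₁ κ₂ : ZpExtension K 3) (γ₁ γ₂ : Field.absoluteGaloisGroup K)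
      [Fact (ZpExtension.IsTopGeneratorPair κ₁ κ₂ γ₁ γ₂)],
    (∀ v : HeightOneSpectrum (𝓞 K), v ≠ 𝔭 → ∀ 𝔓 ∈ v.primesAbove,
        𝔓.inertia (Field.absoluteGaloisGroup K) ≤ κ₁.kerSubgroup) →
    Module.Finite (IwasawaAlgebra₂ 3) ((W.baseChange K).XGr₂ 3 κ₁ κ₂ 𝔭' γ₁ γ₂) →
    Module.IsTorsion (IwasawaAlgebra₂ 3) ((W.baseChange K).XGr₂ 3 κ₁ κ₂ 𝔭' γ₁ γ₂) →
    ∀ (g : IwasawaAlgebra₂ 3),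
      Literature.NumberTheory.EllipticCurves.Module.charIdeal (IwasawaAlgebra₂ 3)
        ((W.baseChange K).XGr₂ 3 κ₁ κ₂ 𝔭' γ₁ γ₂) = Ideal.span {g} →
    ∀ (ΩK' : ℂ) (C X Y : ℂ_[3]) (L₂ : PowerSeries (PowerSeries (unrIntegers 3))), ΩK' ≠ 0 → C ≠ 0 → X ≠ 0 → Y ≠ 0 →
      IsToricTwoVarLFunctionUpTo₂ C X Y ι' 𝔭 𝔭' κ₁ κ₂ γ₁ γ₂ Dt.f ΩK' L₂ →
    ThinCombDvdRat (unrIntegers 3) 3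
      (PowerSeries.map (PowerSeries.map (Summit.BirchSwinnertonDyer.Rank1Residual.X11b.Halves.toUnr 3)) g) L₂) :=
  Iff.rfl

/-- **The registered stub VERBATIM from the item text** (one term): the by-name closure the skeleton's `sorry` :401 waits for. [bookkeeping] -/
theorem stub_ratCombDvdUpTo2_of_item (h : RatCombDvdUpTo2AtThree) :
    ∀ (W : WeierstrassCurve ℚ) [W.IsElliptic] [W.IsGloballyMinimal] (N : ℕ) [NeZero N] (K : Type) [Field K]
      [NumberField K] (Dt : Literature.NumberTheory.EllipticCurves.ModularForms.ModularParametrizationData W N),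
    Summit.BirchSwinnertonDyer.Rank1Residual.Additive.ClassO6 W 3 → W.HasSurjectiveModNGaloisRep 3 →
    W.analyticRank = 1 → W.conductorNorm ℤ = N → IsImaginaryQuadratic K → SatisfiesHeegnerHypothesis N K →
    ∀ (𝔭 : HeightOneSpectrum (𝓞 K)), ((3 : ℕ) : 𝓞 K) ∈ 𝔭.asIdeal →
      𝔭.asIdeal.ramificationIdx (𝓞 ℚ) = 1 → 𝔭.asIdeal.inertiaDeg (𝓞 ℚ) = 1 →
    ∀ (𝔭' : HeightOneSpectrum (𝓞 K)), ((3 : ℕ) : 𝓞 K) ∈ 𝔭'.asIdeal → 𝔭' ≠ 𝔭 →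
    ∀ (ι' : PadicAlgCl 3 ≃+* ℂ), Summit.BirchSwinnertonDyer.BirchSwinnertonDyer.Theorems.SchneiderFree.BranchInducesPrime 3 ι' 𝔭 →
    ∀ (κ₁ κ₂ : ZpExtension K 3) (γ₁ γ₂ : Field.absoluteGaloisGroup K)
      [Fact (ZpExtension.IsTopGeneratorPair κ₁ κ₂ γ₁ γ₂)],
    (∀ v : HeightOneSpectrum (𝓞 K), v ≠ 𝔭 → ∀ 𝔓 ∈ v.primesAbove,
        𝔓.inertia (Field.absoluteGaloisGroup K) ≤ κ₁.kerSubgroup) →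
    Module.Finite (IwasawaAlgebra₂ 3) ((W.baseChange K).XGr₂ 3 κ₁ κ₂ 𝔭' γ₁ γ₂) →
    Module.IsTorsion (IwasawaAlgebra₂ 3) ((W.baseChange K).XGr₂ 3 κ₁ κ₂ 𝔭' γ₁ γ₂) →
    ∀ (g : IwasawaAlgebra₂ 3),
      Literature.NumberTheory.EllipticCurves.Module.charIdeal (IwasawaAlgebra₂ 3)
        ((W.baseChange K).XGr₂ 3 κ₁ κ₂ 𝔭' γ₁ γ₂) = Ideal.span {g} →
    ∀ (ΩK' : ℂ) (C X Y : ℂ_[3]) (L₂ : PowerSeries (PowerSeries (unrIntegers 3))), ΩK' ≠ 0 → C ≠ 0 → X ≠ 0 → Y ≠ 0 →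
      IsToricTwoVarLFunctionUpTo₂ C X Y ι' 𝔭 𝔭' κ₁ κ₂ γ₁ γ₂ Dt.f ΩK' L₂ →
    ThinCombDvdRat (unrIntegers 3) 3
      (PowerSeries.map (PowerSeries.map (Summit.BirchSwinnertonDyer.Rank1Residual.X11b.Halves.toUnr 3)) g) L₂ :=
  h

end Registered

end Summit.BirchSwinnertonDyer.BirchSwinnertonDyer.Cruxes.RationalSplitIMCInclusionAtThree.RatwallThinComb.Stub3ItemText
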